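/-
Copyright (c) 2026 the pub-hodgecm-mathlib formalisation cell (harness21).  Prover seat hodgecm-mathlib-F0P3a-p06 (g26), 2026-09-03.  E1 BRICK LEDGER row 56-B3(61b) «TAME TWIN OF
THE DISCHARGED `hsp` SUPPLIER» (first refusal (c), keeper F0P3a-p03 (g30) FINAL § ∕ (g31) k01 ∕ k22; row 69's `h61ram`, F0P3a-p09 (g16)); census `F0/P3a/STATUS.md` 05:24:15Z.
-/
import Summits.HodgeConjecture.HodgeConjecture.Theorems.F0P3cStCharTSEPInducedTraceZeroAtDatumDischarge       -- ★ 61b (F0P3a-p04 g32): §0 bridge `finrank_intertwiningMap_smoothIndRep_cmBorel_eq` BY NAME; brings ★ 61-G ∕ 5b ∕ 60 ∕ M2–M4 ∕ 61-σ ∕ ED. 1 and the ★ UNR datum files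
import Summits.HodgeConjecture.HodgeConjecture.Theorems.F0P3cStCharTSEPInducedTraceZeroAtDatumRamified        -- ★ 61a-RAM (F0P2-p01 g27) p853584: `…_eq_zero_of_blockSums_of_involution (hvσ hϖ)`
import Summits.HodgeConjecture.HodgeConjecture.Theorems.F0P3cStCharTSHorocycleDataAtDatumRamified            -- ★ FILE 2-RAM (this seat) p853568: (X1)(X2) `_of_neg`; brings ★ FILE 1-RAM p853556 (`τ`, `apartmentEnum_eq_self_…_of_involution`)
import Summits.HodgeConjecture.HodgeConjecture.Theorems.F0P3cStCharTSBorelDoubleCosetsIwahoriAtDatumRamified  -- ★ FILE 4-RAM (LH5-p04 g11) p853593 + ED. 2 dock twin: `borelDoubleCoset_edge_of_neg`, `mapEdgeSet_tau_weylLong_…_of_involution`, `borelDoubleCoset_edge_dock_of_involution`; brings ★ FILE 3-RAM p853571 (X3)(X4) vertices `_of_neg`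
import Summits.HodgeConjecture.HodgeConjecture.Theorems.F0P3cStCharTSTreeOrbitDataGqsRamified               -- ★ (A)-RAM (this seat) p853588: `mem_headOrbit_or_mem_tailOrbit_of_neg`
import Summits.HodgeConjecture.HodgeConjecture.Theorems.F0P3cStCharTSCharacterEllipticUniformRamified       -- ★ H-RAM (LH6-p04 g11) p853513: 41g-H §2 `_of_involution` + (U7) `_of_neg`; brings ★ `isTree_latticeGraph_three_of_neg`
import HarnessLib

/-!
# Row 56-B3(61b) — THE TAME TWIN of ★ 61b «THE `hsp` SUPPLIER, DISCHARGED»: `tr i_G(χ)(f_EP) = 0` for every continuous character `χ` of `T(L⁺_v)` and the Euler–Poincaré function of any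
# smooth `ρ` with finite-dimensional Jacquet module, on the `U(Φ₃)(L⁺_v)` tree at a TAMELY RAMIFIED place (`σ_w ϖ = −ϖ`, `|2|_w = 1`) — Schneider–Stuhler 1997 §III.4; Kottwitz 1988 §2

Cell `pub/hodgecm-mathlib` (D-0151), crux H413 = `stmt-HodgeConjecture-24833`; lane `--kind proof --supports stmt-HodgeConjecture-24833 --as helper` (THEOREMS ONLY: no definition ∕
instance ∕ notation ∕ named fact ∕ `sorry`; count-neutral: closes no node).  Namespace `Summit.HodgeConjecture.HodgeConjecture.Cruxes.H413.F0P3cStCharTSEPInducedTraceZeroAtDatumRamified`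
(= ★ 61a-RAM's; the new FQN `….smoothTrace_cmPrincipalSeries_epFunction_eq_zero_of_neg` is free).  Sibling of ★ 61b `F0P3cStCharTSEPInducedTraceZeroAtDatumDischarge` (F0P3a-p04 (g32)) on
★ B3(53)'s pattern: its HEAD re-issued `_of_neg` with the unramified datum replaced IN ITS SLOT (after `{ϖ}`, before `eA`; all binders explicit in ★) by the seven TAME letters of ★
`isTree_latticeGraph_three_of_neg` (IN ORDER) — row 69's `h61ram` (F0P3a-p09 (g16)) —, every other binder and the conclusion VERBATIM.  The twenty datum reads of ★ 61b go through ★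
tame twins BY NAME (census 05:24:15Z): ★ H-RAM (41g-H §2 ×4 incl. (U7) `_of_neg`), ★ R5a `isSelfDualLattice_latt_diagonal_zpow_of_v`, ★ B1 `apartmentEnum_injective_of_involution` ∕
`latticeGraph_adj_apartmentEnum_succ_of_involution`, ★ FILE 1-RAM (`τ`, `apartmentEnum_eq_self_…_of_involution`), ★ FILE 2-RAM ((X1)(X2) `_of_neg`), ★ (A)-RAM
(`mem_headOrbit_or_mem_tailOrbit_of_neg`), ★ FILE 3-RAM (`borelDoubleCoset_vertex_of_neg` ×2), ★ FILE 4-RAM (`borelDoubleCoset_edge_of_neg`, `mapEdgeSet_tau_weylLong_…_of_involution`,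
`borelDoubleCoset_edge_dock_of_involution`), ★ 61a-RAM (`…_eq_zero_of_blockSums_of_involution`); the datum-free inputs (§0 bridge, ★ 61-G ∕ 5b ∕ 60 ∕ M2–M4 ∕ 61-σ) BY NAME.
HONEST LABEL: count-neutral datum helper; TAME road GO-LOW (LEAD T15-42); WILD (dyadic) places stay PRINT (`h2 : |2| = 1` is a binder); E1 = PRINT until the rider rides; h413
OPEN; HC_CM is proved only modulo the 7 printed citations (2 remaining named inputs hLiu418 = stmt-HodgeConjecture-24832, h413 = stmt-HodgeConjecture-24833) until rung 0 closes;
nothing printed is asserted here.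

## References
* [SchneiderStuhler1997] P. Schneider, U. Stuhler, *Representation theory and sheaves on the Bruhat–Tits building*, Publ. Math. IHÉS 85 (1997): §III.4 Lemma III.4.18.
* [Kottwitz1988] R. E. Kottwitz, *Tamagawa numbers*, Ann. of Math. 127 (1988): §2.
* [Rogawski1990] J. D. Rogawski, *Automorphic Representations of Unitary Groups in Three Variables* (1990): §12.2 p. 173, §12.5 pp. 182–187.
* [BernsteinZelevinsky1977] I. N. Bernstein, A. V. Zelevinsky, *Induced representations of reductive p-adic groups I*, Ann. Sci. ÉNS 10 (1977): §2.3.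
* [Casselman1995] W. Casselman, *Introduction to the theory of admissible representations of p-adic reductive groups* (1995): §6.3.
* [BruhatTits1972] F. Bruhat, J. Tits, *Groupes réductifs sur un corps local* I, Publ. Math. IHÉS 41 (1972): (4.4.3)–(4.4.4), §10.
-/

set_option autoImplicit false

set_option linter.dupNamespace false

noncomputable section

open NumberField IsDedekindDomain MeasureTheory Measure
open scoped Pointwise Valued WithZero Matrix MatrixGroups
open Literature.NumberTheory.Rogawski1990 Literature.NumberTheory.Rogawski1990.Ch12Sec5
open Literature.NumberTheory.Automorphic Literature.NumberTheory.Automorphic.UnitaryGroup Literature.NumberTheory.Automorphic.UnitaryLatticeTree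
open Literature.NumberTheory.Automorphic.HermitianLattice Literature.NumberTheory.GaloisRepresentations
open Literature.Combinatorics.SimpleGraph Literature.Combinatorics.SimpleGraph.OrientedIncidence

namespace Summit.HodgeConjecture.HodgeConjecture.Cruxes.H413.F0P3cStCharTSEPInducedTraceZeroAtDatumRamified

open Summit.HodgeConjecture.HodgeConjecture.Cruxes.H413
open Summit.HodgeConjecture.HodgeConjecture.Cruxes.H413.F0P3cStCharTSCharacterEllipticUniform
open Summit.HodgeConjecture.HodgeConjecture.Cruxes.H413.F0P3cStCharTSCharacterEllipticUniformRamified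
open Summit.HodgeConjecture.HodgeConjecture.Cruxes.H413.F0P3cStCharTSEPFunctionOrbitalOrbits
open Summit.HodgeConjecture.HodgeConjecture.Cruxes.H413.F0P3cStCharTSHorocyclesAtDatum
open Summit.HodgeConjecture.HodgeConjecture.Cruxes.H413.F0P3cStCharTSHorocyclesAtDatumRamified
open Summit.HodgeConjecture.HodgeConjecture.Cruxes.H413.F0P3cStCharTSTreeOrbitDataGqs
open Summit.HodgeConjecture.HodgeConjecture.Cruxes.H413.F0P3cStCharTSTreeOrbitDataGqsRamified
open Summit.HodgeConjecture.HodgeConjecture.Cruxes.H413.F0P3cStCharTSPrincipalSeriesLine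
open Summit.HodgeConjecture.HodgeConjecture.Cruxes.H413.F0P3cStCharTSEPInducedTraceZeroAtDatum

/-! ## §1-RAM `tr i_G(χ)(f_EP) = 0` at the datum at a tame ramified place -/

section Discharge

variable (L : Type) [Field L] [NumberField L] [IsCMField L] (v : HeightOneSpectrum (𝓞 ↥(maximalRealSubfield L)))

set_option maxHeartbeats 3200000 in  -- measured: rc 1 at 1 600 000 (the `hS₁` Finset bookkeeping on the datum edge type); 132 s wall at 3 200 000 — the 41g-H ∕ 48-datum `whnf` wall
/-- **E1 ROW 61b AT A TAMELY RAMIFIED PLACE — `tr i_G(χ)(f_EP) = 0` AT THE DATUM, UNCONDITIONALLY** (twin of ★ 61b `smoothTrace_cmPrincipalSeries_epFunction_eq_zero` = row 69's `h61ram` binder; every datum read ↦ its ★ `_of_involution`∕`_of_neg` twin BY NAME, conclusion and every other binder VERBATIM; edge certificates print ★ B1 `_succ_of_involution`, proof-irrelevant).  At a non-split place `v` of `L⁺`, with the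
(G3)-EXPLICIT one-place model `(w hw ϖ eA heA)` and the seven TAME letters `hσ hvσ hϖ hσϖ hres h2 hnorm` (`σ_w ϖ = −ϖ`, `|2|_w = 1`) in the datum slot, the tree letters of ★ 41g-H, the standard apartment `A` (★ 39γ) and the base edge `d₁ = {A 0, A 1}`, its three stabilisers
`P₀ = Stab(A 0)`, `P₂ = Stab(A 1)`, `P₁ = Stab(d₁)`: for EVERY smooth `ρ` with finite-dimensional Jacquet module and finite-dimensional `V^{U_q}` at the three facets, with `K`-types
`τ_q = ρ|_{P_q}` trivial on `U_q` and pieces `f_q = 𝟙_{P_q}·χ_{τ_q}(·⁻¹)`, and EVERY continuous character `χ` of `T(L⁺_v)`,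
`tr i_G(χ)((ν P₀)⁻¹ • f₀ + (ν P₂)⁻¹ • f₂ − (ν P₁)⁻¹ • f₁) = 0` — ★ ED. 1 §3 with `hEuler` from ★ 5b at the datum and `hm₀ hm₂ hm₁` from ★ 61-G over ★ B-3a ∕ ★ B-3b ∕ ★ 61-σ
(module docstring for the full supplier list).  Shape = cert v6's `h61` after `(w hw) {ϖ} (hσ hvσ hϖ hσϖ hres h2 hnorm) (eA) (heA)` VERBATIM; its one use site pays `heA, A hA0 hA1, rfl, r.isSmooth,
(finrank_coinvariants_le_two L v hns r).1`. [cite: SchneiderStuhler1997, §III.4 Lemma III.4.18] [cite: Kottwitz1988, §2] [cite: Rogawski1990, §12.2 p. 173; §12.5 pp. 182–187]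
[cite: BernsteinZelevinsky1977, §2.3, Thm 5.2] [cite: Casselman1995, §6.3] [cite: BruhatTits1972, (4.4.3)–(4.4.4), §10] -/
theorem smoothTrace_cmPrincipalSeries_epFunction_eq_zero_of_neg
    [MeasurableSpace (Gqs L v)] [BorelSpace (Gqs L v)] (νQv : Measure (Gqs L v)) [νQv.IsHaarMeasure]
    (w : PlacesOver L v) (hw : IsCMField.complexConj L • w.1 = w.1) {ϖ : (w.1.adicCompletion L)}
    (hσ : ∀ x, (galAdicCompletionMap (L := L) (IsCMField.complexConj L) hw) ((galAdicCompletionMap (L := L) (IsCMField.complexConj L) hw) x) = x) (hvσ : ∀ x, Valued.v ((galAdicCompletionMap (L := L) (IsCMField.complexConj L) hw) x) = Valued.v x) (hϖ : Valued.v ϖ = WithZero.exp (-1 : ℤ))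
    (hσϖ : (galAdicCompletionMap (L := L) (IsCMField.complexConj L) hw) ϖ = -ϖ) (hres : ∀ x : (w.1.adicCompletion L), Valued.v x ≤ 1 → Valued.v ((galAdicCompletionMap (L := L) (IsCMField.complexConj L) hw) x - x) < 1) (h2 : Valued.v (2 : (w.1.adicCompletion L)) = 1) (hnorm : ∀ u : (w.1.adicCompletion L), (galAdicCompletionMap (L := L) (IsCMField.complexConj L) hw) u = u → Valued.v (u - 1) < 1 → ∃ z : (w.1.adicCompletion L), z * (galAdicCompletionMap (L := L) (IsCMField.complexConj L) hw) z = u ∧ Valued.v (z - 1) ≤ Valued.v (u - 1))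
    (eA : (Gqs L v) ≃ₜ* ↥(unitaryGroupOfForm (galAdicCompletionMap (L := L) (IsCMField.complexConj L) hw) ((StdForm.antidiagonal 3).over (w.1.adicCompletion L))))
    (heA : ∀ g : Gqs L v,
      ((eA g : ↥(unitaryGroupOfForm (galAdicCompletionMap (L := L) (IsCMField.complexConj L) hw) ((StdForm.antidiagonal 3).over (w.1.adicCompletion L)))) :
          GL (Fin 3) (w.1.adicCompletion L)) =
        ((localNonsplitEquiv (IsCMField.complexConj L) (qsForm L) (IsCMField.complexConj_ne_one L) w hw g :
          ↥(unitaryGroupOfForm (galAdicCompletionMap (L := L) (IsCMField.complexConj L) hw) (placeForm (qsForm L) w.1))) : GL (Fin 3) (w.1.adicCompletion L)))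
    {a : (Gqs L v) →* ((latticeGraph (galAdicCompletionMap (L := L) (IsCMField.complexConj L) hw) ϖ ((StdForm.antidiagonal 3).over (w.1.adicCompletion L))) ≃g (latticeGraph (galAdicCompletionMap (L := L) (IsCMField.complexConj L) hw) ϖ ((StdForm.antidiagonal 3).over (w.1.adicCompletion L))))} (ha : ∀ g, a g = latticeGraphIso (galAdicCompletionMap (L := L) (IsCMField.complexConj L) hw) ϖ ((StdForm.antidiagonal 3).over (w.1.adicCompletion L)) (eA g))
    (τ : Orientation (latticeGraph (galAdicCompletionMap (L := L) (IsCMField.complexConj L) hw) ϖ ((StdForm.antidiagonal 3).over (w.1.adicCompletion L)))) (hτ : ∀ d, τ.tail d < τ.head d)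
    {e : ℕ} {U : {M : Submodule 𝒪[(w.1.adicCompletion L)] (Fin 3 → (w.1.adicCompletion L)) // IsVertex (galAdicCompletionMap (L := L) (IsCMField.complexConj L) hw) ϖ ((StdForm.antidiagonal 3).over (w.1.adicCompletion L)) M} → Subgroup (Gqs L v)}
    (hU : ∀ x g, g ∈ U x ↔ mapGL ((eA g : ↥(unitaryGroupOfForm (galAdicCompletionMap (L := L) (IsCMField.complexConj L) hw) ((StdForm.antidiagonal 3).over (w.1.adicCompletion L)))) : GL (Fin 3) (w.1.adicCompletion L)) x.1 = x.1 ∧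
      x.1.map ((Matrix.toLin' ((((eA g : ↥(unitaryGroupOfForm (galAdicCompletionMap (L := L) (IsCMField.complexConj L) hw) ((StdForm.antidiagonal 3).over (w.1.adicCompletion L)))) : GL (Fin 3) (w.1.adicCompletion L)) : Matrix (Fin 3) (Fin 3) (w.1.adicCompletion L)) - 1)).restrictScalars 𝒪[(w.1.adicCompletion L)]) ≤ scaleLattice (ϖ ^ (e + 1)) x.1)
    (hUo : ∀ x, IsOpen (U x : Set (Gqs L v))) (hUc : ∀ x, IsCompact (U x : Set (Gqs L v)))
    (hEo : ∀ d : (latticeGraph (galAdicCompletionMap (L := L) (IsCMField.complexConj L) hw) ϖ ((StdForm.antidiagonal 3).over (w.1.adicCompletion L))).edgeSet, IsOpen ((U (τ.head d) ⊔ U (τ.tail d) : Subgroup (Gqs L v)) : Set (Gqs L v)))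
    (hEc : ∀ d : (latticeGraph (galAdicCompletionMap (L := L) (IsCMField.complexConj L) hw) ϖ ((StdForm.antidiagonal 3).over (w.1.adicCompletion L))).edgeSet, IsCompact ((U (τ.head d) ⊔ U (τ.tail d) : Subgroup (Gqs L v)) : Set (Gqs L v)))
    -- the standard apartment and the base edge `A 0 — A 1` on it
    {A : ℤ → {M : Submodule 𝒪[(w.1.adicCompletion L)] (Fin 3 → (w.1.adicCompletion L)) // IsVertex (galAdicCompletionMap (L := L) (IsCMField.complexConj L) hw) ϖ ((StdForm.antidiagonal 3).over (w.1.adicCompletion L)) M}}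
    (hA0 : ∀ c : ℤ, (A (2 * c)).1 = latt (Matrix.diagonal ![ϖ ^ c, (1 : w.1.adicCompletion L), ϖ ^ (-c)]))
    (hA1 : ∀ c : ℤ, (A (2 * c + 1)).1 = latt (Matrix.diagonal ![ϖ ^ (c + 1), (1 : w.1.adicCompletion L), ϖ ^ (-c)]))
    (d₁ : (latticeGraph (galAdicCompletionMap (L := L) (IsCMField.complexConj L) hw) ϖ ((StdForm.antidiagonal 3).over (w.1.adicCompletion L))).edgeSet)
    (hd₁ : (d₁ : Sym2 {M : Submodule 𝒪[(w.1.adicCompletion L)] (Fin 3 → (w.1.adicCompletion L)) // IsVertex (galAdicCompletionMap (L := L) (IsCMField.complexConj L) hw) ϖ ((StdForm.antidiagonal 3).over (w.1.adicCompletion L)) M}) = s(A 0, A 1))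
    (P₀ P₂ P₁ : Subgroup (Gqs L v))
    (hP₀ : ∀ g, g ∈ P₀ ↔ a g (τ.head d₁) = τ.head d₁) (hP₂ : ∀ g, g ∈ P₂ ↔ a g (τ.tail d₁) = τ.tail d₁) (hP₁ : ∀ g, g ∈ P₁ ↔ (a g).mapEdgeSet d₁ = d₁)
    {V : Type*} [AddCommGroup V] [Module ℂ V] (ρ : Representation ℂ (Gqs L v) V) (hρ : ρ.IsSmooth)
    (hVN : FiniteDimensional ℂ ((cmBorelTriple L 3 v).restrict ρ).Coinvariants)
    [FiniteDimensional ℂ ↥(ρ.fixedPoints (U (τ.head d₁)))] [FiniteDimensional ℂ ↥(ρ.fixedPoints (U (τ.tail d₁)))]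
    [FiniteDimensional ℂ ↥(ρ.fixedPoints (U (τ.head d₁) ⊔ U (τ.tail d₁)))]
    (τ₀ : Representation ℂ ↥P₀ ↥(ρ.fixedPoints (U (τ.head d₁))))
    (hτρ₀ : ∀ (p : ↥P₀) (x : ↥(ρ.fixedPoints (U (τ.head d₁)))), ((τ₀ p x : ↥(ρ.fixedPoints (U (τ.head d₁)))) : V) = ρ (p : (Gqs L v)) (x : V))
    (hτ₀ : ∀ p : ↥P₀, (p : (Gqs L v)) ∈ U (τ.head d₁) → τ₀ p = 1)
    (τ₂ : Representation ℂ ↥P₂ ↥(ρ.fixedPoints (U (τ.tail d₁))))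
    (hτρ₂ : ∀ (p : ↥P₂) (x : ↥(ρ.fixedPoints (U (τ.tail d₁)))), ((τ₂ p x : ↥(ρ.fixedPoints (U (τ.tail d₁)))) : V) = ρ (p : (Gqs L v)) (x : V))
    (hτ₂ : ∀ p : ↥P₂, (p : (Gqs L v)) ∈ U (τ.tail d₁) → τ₂ p = 1)
    (τ₁ : Representation ℂ ↥P₁ ↥(ρ.fixedPoints (U (τ.head d₁) ⊔ U (τ.tail d₁))))
    (hτρ₁ : ∀ (p : ↥P₁) (x : ↥(ρ.fixedPoints (U (τ.head d₁) ⊔ U (τ.tail d₁)))), ((τ₁ p x : ↥(ρ.fixedPoints (U (τ.head d₁) ⊔ U (τ.tail d₁)))) : V) = ρ (p : (Gqs L v)) (x : V))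
    (hτ₁ : ∀ p : ↥P₁, (p : (Gqs L v)) ∈ U (τ.head d₁) ⊔ U (τ.tail d₁) → τ₁ p = 1)
    {f₀ f₂ f₁ : (Gqs L v) → ℂ}
    (hfP₀ : ∀ (g : (Gqs L v)) (hg : g ∈ P₀), f₀ g = Representation.character τ₀ ⟨g, hg⟩⁻¹) (hf0₀ : ∀ g ∉ P₀, f₀ g = 0)
    (hfP₂ : ∀ (g : (Gqs L v)) (hg : g ∈ P₂), f₂ g = Representation.character τ₂ ⟨g, hg⟩⁻¹) (hf0₂ : ∀ g ∉ P₂, f₂ g = 0)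
    (hfP₁ : ∀ (g : (Gqs L v)) (hg : g ∈ P₁), f₁ g = Representation.character τ₁ ⟨g, hg⟩⁻¹) (hf0₁ : ∀ g ∉ P₁, f₁ g = 0)
    (χ : ↥(cmBorelTriple L 3 v).M →* ℂˣ) (hχ : Continuous fun t => ((χ t : ℂˣ) : ℂ)) :
    Representation.smoothTrace (G := Gqs L v) (UnitaryGroup.cmPrincipalSeries L 3 v χ) νQv
        ((((νQv.real (P₀ : Set (Gqs L v)))⁻¹ : ℂ)) • f₀ + (((νQv.real (P₂ : Set (Gqs L v)))⁻¹ : ℂ)) • f₂ - (((νQv.real (P₁ : Set (Gqs L v)))⁻¹ : ℂ)) • f₁) = 0 := by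
  classical
  haveI : NonarchimedeanGroup (Gqs L v) :=
    nonarchimedeanGroup_unitaryGroupOfForm_local (E := L) (c := IsCMField.complexConj L) (N := 3) (v := v) (J' := (adelicForm L 3 (qsForm L)).map (adeleToLocal L v))
  -- §A the tree axioms at the datum (★ 41g-H §2)
  have hT := isTree_latticeGraph_three_of_neg hσ hvσ hϖ hσϖ hres h2 hnorm
  have hσa : ∀ (g : Gqs L v) (d : (latticeGraph (galAdicCompletionMap (L := L) (IsCMField.complexConj L) hw) ϖ ((StdForm.antidiagonal 3).over (w.1.adicCompletion L))).edgeSet),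
      τ.head ((a g).mapEdgeSet d) = a g (τ.head d) ∧ τ.tail ((a g).mapEdgeSet d) = a g (τ.tail d) := fun g d => by
    rw [ha]; exact head_mapEdgeSet_latticeGraphIso (galAdicCompletionMap (L := L) (IsCMField.complexConj L) hw) ϖ ((StdForm.antidiagonal 3).over (w.1.adicCompletion L)) hτ (eA g) d
  have hstab := isOpen_setOf_actionHom_apply_eq (L := L) (v := v) (w := w) (hw := hw) (eA := eA) ha
  have hU6 := fun x y (hxy : (latticeGraph (galAdicCompletionMap (L := L) (IsCMField.complexConj L) hw) ϖ ((StdForm.antidiagonal 3).over (w.1.adicCompletion L))).Adj x y) =>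
    coe_sup_unitaryLevel_gqs_eq_mul_of_adj_of_involution (eA := eA) hU hvσ hϖ hxy
  have hU7 := fun x y z (hxy : (latticeGraph (galAdicCompletionMap (L := L) (IsCMField.complexConj L) hw) ϖ ((StdForm.antidiagonal 3).over (w.1.adicCompletion L))).Adj x y)
      (hyz : (latticeGraph (galAdicCompletionMap (L := L) (IsCMField.complexConj L) hw) ϖ ((StdForm.antidiagonal 3).over (w.1.adicCompletion L))).dist y z + 1 =
        (latticeGraph (galAdicCompletionMap (L := L) (IsCMField.complexConj L) hw) ϖ ((StdForm.antidiagonal 3).over (w.1.adicCompletion L))).dist x z) =>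
    coe_unitaryLevel_gqs_subset_mul_of_adj_of_dist_of_neg (eA := eA) hU hσ hvσ hϖ hσϖ hres h2 hnorm hxy hyz
  have hUa := unitaryLevel_gqs_actionHom_eq_map_conj (eA := eA) ha hU
  -- §B the base edge is the apartment edge: `τ.head d₁ = A 0`, `τ.tail d₁ = A 1` (heads have type `0`, ★ `type_of_lt_three`)
  have hϖ1 : Valued.v ϖ ≤ 1 := v_le_one_of_v_eq_exp_neg_one hϖ
  have hϖ0 : ϖ ≠ 0 := CartanUnique.uniformizer_ne_zero hϖ
  have hJ : Valued.v (((StdForm.antidiagonal 3).over (w.1.adicCompletion L))).det = 1 := v_det_antidiagonal_three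
  have hAinj := apartmentEnum_injective_of_involution hϖ A hA0 hA1
  have hsd0 : IsVertexLattice (galAdicCompletionMap (L := L) (IsCMField.complexConj L) hw) ϖ ((StdForm.antidiagonal 3).over (w.1.adicCompletion L)) 0 (A 0).1 := by
    have h := hA0 0
    rw [show (2 : ℤ) * 0 = 0 from rfl] at h
    rw [h]
    exact isSelfDualLattice_latt_diagonal_zpow_of_v hσ hvσ hϖ 0
  have hd₁A : τ.head d₁ = A 0 ∧ τ.tail d₁ = A 1 := by
    have hm0 : A 0 ∈ (d₁ : Sym2 _) := by rw [hd₁]; exact Sym2.mem_mk_left _ _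
    have hm1 : A 1 ∈ (d₁ : Sym2 _) := by rw [hd₁]; exact Sym2.mem_mk_right _ _
    have h01 : A 0 ≠ A 1 := fun h => by have := hAinj h; omega
    rcases τ.mem_iff.1 hm0 with h0 | h0
    · refine ⟨h0.symm, ?_⟩
      rcases τ.mem_iff.1 hm1 with h1 | h1
      · exact absurd (h0.trans h1.symm) h01
      · exact h1.symm
    · exfalso
      obtain ⟨k₀, hk₀⟩ := (τ.head d₁).2
      have hsd : IsVertexLattice (galAdicCompletionMap (L := L) (IsCMField.complexConj L) hw) ϖ ((StdForm.antidiagonal 3).over (w.1.adicCompletion L)) 0 (τ.tail d₁).1 := by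
        rw [← h0]; exact hsd0
      have h2 := (type_of_lt_three hvσ hϖ hJ hsd hk₀ (Subtype.coe_lt_coe.2 (hτ d₁))).1
      omega
  have hde : d₁ = ⟨s(A 0, A (0 + 1)), (SimpleGraph.mem_edgeSet _).2 (latticeGraph_adj_apartmentEnum_succ_of_involution hσ hvσ hϖ A hA0 hA1 0)⟩ :=
    Subtype.ext (show (d₁ : Sym2 _) = s(A 0, A (0 + 1)) by rw [hd₁]; norm_num)
  obtain ⟨hhd, htl⟩ := hd₁A
  have hP₁e : ∀ g, g ∈ P₁ ↔ (a g).mapEdgeSet (⟨s(A 0, A (0 + 1)), (SimpleGraph.mem_edgeSet _).2 (latticeGraph_adj_apartmentEnum_succ_of_involution hσ hvσ hϖ A hA0 hA1 0)⟩ : (latticeGraph (galAdicCompletionMap (L := L) (IsCMField.complexConj L) hw) ϖ ((StdForm.antidiagonal 3).over (w.1.adicCompletion L))).edgeSet) =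
      ⟨s(A 0, A (0 + 1)), (SimpleGraph.mem_edgeSet _).2 (latticeGraph_adj_apartmentEnum_succ_of_involution hσ hvσ hϖ A hA0 hA1 0)⟩ := fun g => by rw [hP₁, hde]
  have hP₀' : ∀ g, g ∈ P₀ ↔ a g (A 0) = A 0 := fun g => by rw [hP₀, hhd]
  have hP₂' : ∀ g, g ∈ P₂ ↔ a g (A 1) = A 1 := fun g => by rw [hP₂, htl]
  -- §C the Borel triple, the torus translation (★ B-1 (X0)), the horocycle data (★ B-2), the compact torus `C = T ∩ Stab(A 0)`
  have hN := UnitaryGroup.isLimitOfCompactOpen_cmBorelTriple_N L 3 v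
  obtain ⟨τM, hτM, -, hτA⟩ := exists_mem_cmBorelTriple_M_apartmentEnum_eq_add_two_of_involution L v w hw eA heA ha A hA0 hA1 hσ hvσ hϖ
  obtain ⟨rep₀, tr₀, ht₀, htrN₀, hrepR₀, htr₀, hrep_act₀, hrep_id₀, hsh₀, hsh₀', hCR₀, hS₀⟩ :=
    exists_horocycleData_vertices_of_neg L v w hw eA heA ha A hA0 hA1 hσ hvσ hϖ hσϖ hres h2 hnorm P₀ hP₀' τM hτA
  obtain ⟨rep₁, tr₁, ht₁, htrN₁, hrepR₁, htr₁, hrep_act₁, hrep_id₁, hsh₁, hsh₁', hCR₁, hS₁⟩ :=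
    exists_horocycleData_edges_of_neg L v w hw eA heA ha A hA0 hA1 hσ hvσ hϖ hσϖ hres h2 hnorm P₀ hP₀' τM hτA
  have hC : IsCompact ((((cmBorelTriple L 3 v : ParabolicTriple (Gqs L v)).M ⊓ P₀ : Subgroup (Gqs L v)) : Set (Gqs L v))) :=
    isCompact_cmBorelTriple_M_inf L v w hw eA heA ha P₀ (A 0) hP₀'
  have hCτ : ∀ c : Gqs L v, c ∈ (cmBorelTriple L 3 v : ParabolicTriple (Gqs L v)).M ⊓ P₀ → c * τM = τM * c := fun c hc =>
    mul_comm_of_mem_cmBorelTriple_M L v w hw eA heA (Subgroup.mem_inf.1 hc).1 hτM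
  have hCP : (cmBorelTriple L 3 v : ParabolicTriple (Gqs L v)).M ⊓ P₀ ≤ (cmBorelTriple L 3 v : ParabolicTriple (Gqs L v)).P :=
    inf_le_left.trans (cmBorelTriple L 3 v : ParabolicTriple (Gqs L v)).M_le
  -- §D the inducing character `χ̃ = δ_B^{1/2} · (χ ∘ proj)` of `B`, its restriction to `C`, open kernels
  haveI := locallyCompactSpace_cmBorelU L 3 v
  haveI : NonarchimedeanGroup ↥(unitaryGroupOfForm (conjLocal L (IsCMField.complexConj L) v) (cmLocalForm L 3 v)) := ‹NonarchimedeanGroup (Gqs L v)›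
  letI : MeasurableSpace ↥(cmBorelTriple L 3 v : ParabolicTriple (Gqs L v)).P := borel _
  haveI : BorelSpace ↥(cmBorelTriple L 3 v : ParabolicTriple (Gqs L v)).P := ⟨rfl⟩
  obtain ⟨χH, hχH⟩ : ∃ χH : ↥(cmBorelTriple L 3 v : ParabolicTriple (Gqs L v)).P →* ℂˣ,
      ∀ b, χH b = rootDeltaChar (cmBorelTriple L 3 v : ParabolicTriple (Gqs L v)).P b * χ ((cmBorelTriple L 3 v : ParabolicTriple (Gqs L v)).proj b) :=
    ⟨rootDeltaChar (cmBorelTriple L 3 v : ParabolicTriple (Gqs L v)).P * χ.comp (cmBorelTriple L 3 v : ParabolicTriple (Gqs L v)).proj, fun b => rfl⟩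
  have hχHc : Continuous fun b : ↥(cmBorelTriple L 3 v : ParabolicTriple (Gqs L v)).P => ((χH b : ℂˣ) : ℂ) := by
    simp only [hχH, Units.val_mul]
    exact (continuous_rootDeltaChar_unitsCoe' (cmBorelTriple L 3 v : ParabolicTriple (Gqs L v)).P).mul
      (continuous_apply_proj_borelTriple (conjLocal L (IsCMField.complexConj L) v) (cmLocalForm L 3 v) (cmLocalForm_eq_over L 3 v) χ hχ)
  have hχHo : IsOpen (χH.ker : Set ↥(cmBorelTriple L 3 v : ParabolicTriple (Gqs L v)).P) :=
    Representation.isOpen_ker_of_continuous_coe _ χH hχHc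
  obtain ⟨χC, hχC⟩ : ∃ χC : ↥((cmBorelTriple L 3 v : ParabolicTriple (Gqs L v)).M ⊓ P₀) →* ℂˣ, ∀ c, χC c = χH (Subgroup.inclusion hCP c) :=
    ⟨χH.comp (Subgroup.inclusion hCP), fun c => rfl⟩
  have hχCo : IsOpen (χC.ker : Set ↥((cmBorelTriple L 3 v : ParabolicTriple (Gqs L v)).M ⊓ P₀)) := by
    refine Representation.isOpen_ker_of_continuous_coe _ χC ?_
    simp only [hχC]
    exact hχHc.comp (continuous_inclusion hCP)
  -- §E the Schneider–Stuhler complex of `ρ` on the whole tree (★ 41d-II, ★ 5a), finiteness of every `V^{U_x}` and of `(V|_X)_N`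
  obtain ⟨τc, hτc⟩ := Representation.exists_rep_zeroChains a ρ
  obtain ⟨τc₁, hτc₁⟩ := Representation.exists_rep_oneChains a ρ
  obtain ⟨ρ₁, ρ₀, ρV, hρ₁, hρ₀, hρV⟩ := Representation.exists_reps_univ hτc hτc₁ τ U hUa hσa
  obtain ⟨D, hD⟩ := Representation.exists_boundaryMap (k := ℂ) (V := V) τ
  obtain ⟨E, hE⟩ := Representation.exists_augmentationMap (k := ℂ) (V := V)
    (ι := {M : Submodule 𝒪[(w.1.adicCompletion L)] (Fin 3 → (w.1.adicCompletion L)) // IsVertex (galAdicCompletionMap (L := L) (IsCMField.complexConj L) hw) ϖ ((StdForm.antidiagonal 3).over (w.1.adicCompletion L)) M})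
  have hfd : ∀ x, FiniteDimensional ℂ ↥(ρ.fixedPoints (U x)) := fun x => by
    rcases mem_headOrbit_or_mem_tailOrbit_of_neg L v w hw hσ hvσ hϖ hσϖ hres h2 hnorm eA ha τ hτ d₁ x with ⟨g, hg⟩ | ⟨g, hg⟩
    · rw [← hg, ← Representation.map_fixedPoints_eq_fixedPoints_act hUa g (τ.head d₁)]
      infer_instance
    · rw [← hg, ← Representation.map_fixedPoints_eq_fixedPoints_act hUa g (τ.tail d₁)]
      infer_instance
  obtain ⟨ιV, hιV⟩ : ∃ ιV : ρV.IntertwiningMap ρ, ∀ x, ιV x = (x : V) :=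
    ⟨⟨Submodule.subtype _, fun g => LinearMap.ext fun x => hρV g x⟩, fun x => rfl⟩
  have hιVinj : Function.Injective ιV := fun x y h => Subtype.ext (by rwa [hιV, hιV] at h)
  haveI hVN' : FiniteDimensional ℂ ((cmBorelTriple L 3 v : ParabolicTriple (Gqs L v)).restrict ρV).Coinvariants :=
    haveI := hVN
    Module.Finite.of_injective (Representation.jacquetMap (cmBorelTriple L 3 v : ParabolicTriple (Gqs L v)) ιV).toLinearMap
      (UnitaryGroup.jacquetMap_cmBorel_injective L 3 v hρ ιV hιVinj)
  -- §F the `χ̃`-eigenspaces of the compact torus in the three Jacquet modules (★ M3) and the JACQUET EULER IDENTITY (★ 5b)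
  have hCM : (cmBorelTriple L 3 v : ParabolicTriple (Gqs L v)).M ⊓ P₀ ≤ (cmBorelTriple L 3 v : ParabolicTriple (Gqs L v)).M := inf_le_left
  obtain ⟨E₁, hE₁⟩ := Representation.exists_eigenSubmodule
    (fun c : ↥((cmBorelTriple L 3 v : ParabolicTriple (Gqs L v)).M ⊓ P₀) =>
      (ρ₁.jacquetModule (cmBorelTriple L 3 v : ParabolicTriple (Gqs L v)) ⟨c.1, hCM c.2⟩ : _ →ₗ[ℂ] _))
    (fun c => ((χC c : ℂˣ) : ℂ))
  obtain ⟨E₀, hE₀⟩ := Representation.exists_eigenSubmodule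
    (fun c : ↥((cmBorelTriple L 3 v : ParabolicTriple (Gqs L v)).M ⊓ P₀) =>
      (ρ₀.jacquetModule (cmBorelTriple L 3 v : ParabolicTriple (Gqs L v)) ⟨c.1, hCM c.2⟩ : _ →ₗ[ℂ] _))
    (fun c => ((χC c : ℂˣ) : ℂ))
  obtain ⟨EV, hEV⟩ := Representation.exists_eigenSubmodule
    (fun c : ↥((cmBorelTriple L 3 v : ParabolicTriple (Gqs L v)).M ⊓ P₀) =>
      (ρV.jacquetModule (cmBorelTriple L 3 v : ParabolicTriple (Gqs L v)) ⟨c.1, hCM c.2⟩ : _ →ₗ[ℂ] _))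
    (fun c => ((χC c : ℂˣ) : ℂ))
  have hS₀f : ∀ r, r ∈ ({A 0, A 1} : Finset _) ↔ r ∈ Set.range A ∧ ht₀ r = 0 := fun r =>
    (Finset.mem_insert.trans (or_congr Iff.rfl Finset.mem_singleton)).trans (hS₀ r).symm
  have hS₁f : ∀ r, r ∈ ({(⟨s(A 0, A (0 + 1)), (SimpleGraph.mem_edgeSet _).2 (latticeGraph_adj_apartmentEnum_succ_of_involution hσ hvσ hϖ A hA0 hA1 0)⟩ : (latticeGraph (galAdicCompletionMap (L := L) (IsCMField.complexConj L) hw) ϖ ((StdForm.antidiagonal 3).over (w.1.adicCompletion L))).edgeSet),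
      (⟨s(A 1, A (1 + 1)), (SimpleGraph.mem_edgeSet _).2 (latticeGraph_adj_apartmentEnum_succ_of_involution hσ hvσ hϖ A hA0 hA1 1)⟩ : (latticeGraph (galAdicCompletionMap (L := L) (IsCMField.complexConj L) hw) ϖ ((StdForm.antidiagonal 3).over (w.1.adicCompletion L))).edgeSet)} : Finset _) ↔
      r ∈ (Set.range fun j : ℤ => (⟨s(A j, A (j + 1)), (SimpleGraph.mem_edgeSet _).2 (latticeGraph_adj_apartmentEnum_succ_of_involution hσ hvσ hϖ A hA0 hA1 j)⟩ : (latticeGraph (galAdicCompletionMap (L := L) (IsCMField.complexConj L) hw) ϖ ((StdForm.antidiagonal 3).over (w.1.adicCompletion L))).edgeSet)) ∧ ht₁ r = 0 := fun r =>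
    (Finset.mem_insert.trans (or_congr Iff.rfl Finset.mem_singleton)).trans (hS₁ r).symm
  have hEuler := Representation.sum_finrank_block_eigen_eq_of_tree hτc hτc₁ hT τ U hUc hUo hU6 hU7 hUa hσa hstab hρ hfd hD hE hρ₁ hρ₀ hρV
    (cmBorelTriple L 3 v : ParabolicTriple (Gqs L v)) hN rep₁ tr₁ htrN₁ hrepR₁ htr₁ hrep_act₁ hrep_id₁ ht₁ rep₀ tr₀ htrN₀ hrepR₀ htr₀ hrep_act₀ hrep_id₀ ht₀
    hτM hsh₁ hsh₁' hsh₀ hsh₀' hVN' ((cmBorelTriple L 3 v : ParabolicTriple (Gqs L v)).M ⊓ P₀) hCM hC hCτ hCR₁ hCR₀ χC hχCo hE₁ hE₀ hEV _ hS₁f _ hS₀f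
  -- §G THE THREE BLOCKWISE MULTIPLICITIES (★ 61-G over ★ B-3a ∕ ★ B-3b and ★ 61-σ)
  -- the inducing line
  have hσχ : ∀ (h : ↥(cmBorelTriple L 3 v : ParabolicTriple (Gqs L v)).P) (z : ℂ),
      Representation.twist ((((Representation.trivial ℂ ↥(cmBorelTriple L 3 v : ParabolicTriple (Gqs L v)).M ℂ).twist χ).comp
        (cmBorelTriple L 3 v : ParabolicTriple (Gqs L v)).proj)) (rootDeltaChar (cmBorelTriple L 3 v : ParabolicTriple (Gqs L v)).P) h z = ((χH h : ℂˣ) : ℂ) • z :=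
    fun h z => by rw [hχH]; exact cmBorel_line_apply L v χ h z
  have hNχ : ∀ (n : Gqs L v) (hn : n ∈ (cmBorelTriple L 3 v : ParabolicTriple (Gqs L v)).P), n ∈ (cmBorelTriple L 3 v : ParabolicTriple (Gqs L v)).N → χH ⟨n, hn⟩ = 1 :=
    fun n hn hnN => by rw [hχH]; exact cmBorel_lineChar_eq_one_of_mem_N L v χ n hn hnN
  have hW1 : Module.finrank ℂ ℂ = 1 := Module.finrank_self ℂ
  have hχC' : ∀ c : ↥((cmBorelTriple L 3 v : ParabolicTriple (Gqs L v)).M ⊓ P₀),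
      ((χC c : ℂˣ) : ℂ) = ((χH ⟨c.1, (cmBorelTriple L 3 v : ParabolicTriple (Gqs L v)).M_le (hCM c.2)⟩ : ℂˣ) : ℂ) := fun c => by
    rw [hχC]; rfl
  -- stabilisers: `U_q ≤ P_q`, openness, smoothness of the `K`-types (★ 61-σ)
  have hUP₀ : U (τ.head d₁) ≤ P₀ := fun u hu => (hP₀ u).2 (actionHom_apply_eq_of_mem ha hU hu)
  have hUP₂ : U (τ.tail d₁) ≤ P₂ := fun u hu => (hP₂ u).2 (actionHom_apply_eq_of_mem ha hU hu)
  have hfixE := mapEdgeSet_eq_iff L v w hw eA ha τ hτ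
  have hadj₁ := τ.adj_head_tail d₁
  have hUP₁ : U (τ.head d₁) ⊔ U (τ.tail d₁) ≤ P₁ :=
    sup_le (fun u hu => (hP₁ u).2 ((hfixE u d₁).2 ⟨actionHom_apply_eq_of_mem ha hU hu, actionHom_apply_eq_of_mem_of_adj_of_involution ha hU hvσ hϖ hu hadj₁⟩))
      (fun u hu => (hP₁ u).2 ((hfixE u d₁).2 ⟨actionHom_apply_eq_of_mem_of_adj_of_involution ha hU hvσ hϖ hu hadj₁.symm, actionHom_apply_eq_of_mem ha hU hu⟩))
  have hP₀o : IsOpen (P₀ : Set (Gqs L v)) := by rw [Set.ext hP₀]; exact hstab _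
  have hP₂o : IsOpen (P₂ : Set (Gqs L v)) := by rw [Set.ext hP₂]; exact hstab _
  have hP₁o : IsOpen (P₁ : Set (Gqs L v)) := Subgroup.isOpen_mono hUP₁ (hEo d₁)
  have hτsm₀ : τ₀.IsSmooth := isSmooth_of_apply_eq_one_of_le hUP₀ (hUo _) τ₀ fun u hu => hτ₀ ⟨u, hUP₀ hu⟩ hu
  have hτsm₂ : τ₂.IsSmooth := isSmooth_of_apply_eq_one_of_le hUP₂ (hUo _) τ₂ fun u hu => hτ₂ ⟨u, hUP₂ hu⟩ hu
  have hτsm₁ : τ₁.IsSmooth := isSmooth_of_apply_eq_one_of_le hUP₁ (hEo d₁) τ₁ fun u hu => hτ₁ ⟨u, hUP₁ hu⟩ hu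
  -- (X3)(X4): the three Borel double-coset packages (★ B-3a at `A 0`, `A 1`; ★ B-3b at the Iwahori)
  obtain ⟨hcov₀, hdj₀, hT₀, hdec₀, hC₀⟩ := borelDoubleCoset_vertex_of_neg L v w hw eA heA ha A hA0 hA1 (cmBorelTriple L 3 v : ParabolicTriple (Gqs L v)) rfl τM hτM hτA hσ hvσ hϖ hσϖ hres h2 hnorm
    (Or.inl rfl) P₀ P₀ hP₀' hP₀'
  obtain ⟨hcov₂, hdj₂, hT₂, hdec₂, hC₂⟩ := borelDoubleCoset_vertex_of_neg L v w hw eA heA ha A hA0 hA1 (cmBorelTriple L 3 v : ParabolicTriple (Gqs L v)) rfl τM hτM hτA hσ hvσ hϖ hσϖ hres h2 hnorm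
    (Or.inr rfl) P₀ P₂ hP₀' hP₂'
  obtain ⟨hcov₁, hdj₁, hT₁, hdec₁, hC₁⟩ := borelDoubleCoset_edge_of_neg L v w hw eA heA ha A hA0 hA1 (cmBorelTriple L 3 v : ParabolicTriple (Gqs L v)) rfl τM hτM hτA hσ hvσ hϖ hσϖ hres h2 hnorm
    P₀ P₁ hP₀' hP₁e
  obtain ⟨-, hCT₁, hr₁e⟩ := borelDoubleCoset_edge_dock_of_involution L v w hw eA heA ha A hA0 hA1 (cmBorelTriple L 3 v : ParabolicTriple (Gqs L v)) rfl τM hτA hσ hvσ hϖ P₀ P₁ hP₀' hP₁e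
  have hr₁ : ∀ i : Fin 2, (a (![(1 : Gqs L v), τM * eA.symm (weylLongU (galAdicCompletionMap (L := L) (IsCMField.complexConj L) hw) rfl)] i)).mapEdgeSet d₁ ∈
      (Set.range fun j : ℤ => (⟨s(A j, A (j + 1)), (SimpleGraph.mem_edgeSet _).2 (latticeGraph_adj_apartmentEnum_succ_of_involution hσ hvσ hϖ A hA0 hA1 j)⟩ : (latticeGraph (galAdicCompletionMap (L := L) (IsCMField.complexConj L) hw) ϖ ((StdForm.antidiagonal 3).over (w.1.adicCompletion L))).edgeSet)) :=
    fun i => by rw [hde]; exact hr₁e i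
  have hCT₀ : ∀ _ : Unit, ((cmBorelTriple L 3 v : ParabolicTriple (Gqs L v)).M ⊓ P₀ : Subgroup (Gqs L v)) ≤ (cmBorelTriple L 3 v : ParabolicTriple (Gqs L v)).P ⊓ P₀ :=
    fun _ c hc => Subgroup.mem_inf.2 ⟨(cmBorelTriple L 3 v : ParabolicTriple (Gqs L v)).M_le (Subgroup.mem_inf.1 hc).1, (Subgroup.mem_inf.1 hc).2⟩
  have hCT₂ : ∀ _ : Unit, ((cmBorelTriple L 3 v : ParabolicTriple (Gqs L v)).M ⊓ P₀ : Subgroup (Gqs L v)) ≤ (cmBorelTriple L 3 v : ParabolicTriple (Gqs L v)).P ⊓ P₂ :=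
    fun _ c hc => Subgroup.mem_inf.2 ⟨(cmBorelTriple L 3 v : ParabolicTriple (Gqs L v)).M_le (Subgroup.mem_inf.1 hc).1,
      (hP₂' c).2 (apartmentEnum_eq_self_of_mem_cmBorelTriple_M_of_apply_zero_of_involution L v w hw eA heA ha A hA0 hA1 hσ hvσ hϖ (Subgroup.mem_inf.1 hc).1 ((hP₀' c).1 (Subgroup.mem_inf.1 hc).2) 1)⟩
  have hone : ∀ x : {M : Submodule 𝒪[(w.1.adicCompletion L)] (Fin 3 → (w.1.adicCompletion L)) // IsVertex (galAdicCompletionMap (L := L) (IsCMField.complexConj L) hw) ϖ ((StdForm.antidiagonal 3).over (w.1.adicCompletion L)) M},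
      a 1 x = x := fun x => by rw [map_one]; rfl
  have hr₀ : ∀ _ : Unit, a ((fun _ : Unit => (1 : Gqs L v)) ()) (τ.head d₁) ∈ Set.range A :=
    fun _ => ⟨0, by rw [hone, hhd]⟩
  have hr₂ : ∀ _ : Unit, a ((fun _ : Unit => (1 : Gqs L v)) ()) (τ.tail d₁) ∈ Set.range A :=
    fun _ => ⟨1, by rw [hone, htl]⟩
  -- ★ 61-G, three times
  have hm₀ := Representation.finrank_intertwiningMap_smoothIndRep_eq_sum_block_eigen_zeroChains hτc U hUa hρ hfd hρ₀
    (cmBorelTriple L 3 v : ParabolicTriple (Gqs L v)) _ χH hσχ hχHo hNχ hW1 (τ.head d₁) P₀ hP₀ hP₀o τ₀ hτρ₀ hτsm₀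
    (fun _ : Unit => (1 : Gqs L v)) hcov₀ hdj₀ (fun _ => (cmBorelTriple L 3 v : ParabolicTriple (Gqs L v)).P ⊓ P₀) hT₀
    ((cmBorelTriple L 3 v : ParabolicTriple (Gqs L v)).M ⊓ P₀) hCM hCT₀ hdec₀ hC₀ rep₀ tr₀ htrN₀ htr₀ hrep_act₀ hrep_id₀ hr₀ χC hχC' hE₀
  have hm₂ := Representation.finrank_intertwiningMap_smoothIndRep_eq_sum_block_eigen_zeroChains hτc U hUa hρ hfd hρ₀
    (cmBorelTriple L 3 v : ParabolicTriple (Gqs L v)) _ χH hσχ hχHo hNχ hW1 (τ.tail d₁) P₂ hP₂ hP₂o τ₂ hτρ₂ hτsm₂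
    (fun _ : Unit => (1 : Gqs L v)) hcov₂ hdj₂ (fun _ => (cmBorelTriple L 3 v : ParabolicTriple (Gqs L v)).P ⊓ P₂) hT₂
    ((cmBorelTriple L 3 v : ParabolicTriple (Gqs L v)).M ⊓ P₀) hCM hCT₂ hdec₂ hC₂ rep₀ tr₀ htrN₀ htr₀ hrep_act₀ hrep_id₀ hr₂ χC hχC' hE₀
  have hfd₁ : ∀ e : (latticeGraph (galAdicCompletionMap (L := L) (IsCMField.complexConj L) hw) ϖ ((StdForm.antidiagonal 3).over (w.1.adicCompletion L))).edgeSet,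
      FiniteDimensional ℂ ↥(ρ.fixedPoints (U (τ.head e) ⊔ U (τ.tail e))) := fun e =>
    haveI := hfd (τ.head e)
    Submodule.finiteDimensional_of_le (fun v hv => (Representation.mem_fixedPoints _ _ _).2 fun u hu => (Representation.mem_fixedPoints _ _ _).1 hv u (Subgroup.mem_sup_left hu))
  have hm₁ := Representation.finrank_intertwiningMap_smoothIndRep_eq_sum_block_eigen_oneChains hτc₁ τ U hUa hσa hρ hfd₁ hρ₁
    (cmBorelTriple L 3 v : ParabolicTriple (Gqs L v)) _ χH hσχ hχHo hNχ hW1 d₁ P₁ hP₁ hP₁o τ₁ hτρ₁ hτsm₁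
    _ hcov₁ hdj₁ _ hT₁ ((cmBorelTriple L 3 v : ParabolicTriple (Gqs L v)).M ⊓ P₀) hCM hCT₁ hdec₁ hC₁ rep₁ tr₁ htrN₁ htr₁ hrep_act₁ hrep_id₁ hr₁ χC hχC' hE₁
  -- §H the carrier bridge (★ 61-σ (β), `rfl` isolated) and ★ ED. 1 §3
  replace hm₀ := (finrank_intertwiningMap_smoothIndRep_cmBorel_eq L v χ τ₀).symm.trans hm₀
  replace hm₂ := (finrank_intertwiningMap_smoothIndRep_cmBorel_eq L v χ τ₂).symm.trans hm₂
  replace hm₁ := (finrank_intertwiningMap_smoothIndRep_cmBorel_eq L v χ τ₁).symm.trans hm₁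
  have h01 : A 0 ≠ A 1 := fun h => by have := hAinj h; omega
  have hE1 := mapEdgeSet_tau_weylLong_apartmentEnum_zero_of_involution L v w hw eA ha A hA0 hA1 τM hτA hσ hvσ hϖ
  have he01 : (⟨s(A 0, A (0 + 1)), (SimpleGraph.mem_edgeSet _).2 (latticeGraph_adj_apartmentEnum_succ_of_involution hσ hvσ hϖ A hA0 hA1 0)⟩ : (latticeGraph (galAdicCompletionMap (L := L) (IsCMField.complexConj L) hw) ϖ ((StdForm.antidiagonal 3).over (w.1.adicCompletion L))).edgeSet) ≠
      ⟨s(A 1, A (1 + 1)), (SimpleGraph.mem_edgeSet _).2 (latticeGraph_adj_apartmentEnum_succ_of_involution hσ hvσ hϖ A hA0 hA1 1)⟩ := by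
    intro h
    have h' : s(A 0, A (0 + 1)) = s(A 1, A (1 + 1)) := congrArg Subtype.val h
    have hmem : A 0 ∈ s(A 1, A (1 + 1)) := by rw [← h']; exact Sym2.mem_mk_left _ _
    rcases Sym2.mem_iff.1 hmem with h0 | h0
    · exact h01 h0
    · have := hAinj h0; omega
  -- the two Mackey edge representatives land on `e₀`, `e₁`
  have hg0 : (a (![(1 : Gqs L v), τM * eA.symm (weylLongU (galAdicCompletionMap (L := L) (IsCMField.complexConj L) hw) rfl)] 0)).mapEdgeSet d₁ =
      ⟨s(A 0, A (0 + 1)), (SimpleGraph.mem_edgeSet _).2 (latticeGraph_adj_apartmentEnum_succ_of_involution hσ hvσ hϖ A hA0 hA1 0)⟩ := by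
    rw [Matrix.cons_val_zero, hde]; exact mapEdgeSet_actionHom_one L v w hw eA ha _
  have hg1 : (a (![(1 : Gqs L v), τM * eA.symm (weylLongU (galAdicCompletionMap (L := L) (IsCMField.complexConj L) hw) rfl)] 1)).mapEdgeSet d₁ =
      ⟨s(A 1, A (1 + 1)), (SimpleGraph.mem_edgeSet _).2 (latticeGraph_adj_apartmentEnum_succ_of_involution hσ hvσ hϖ A hA0 hA1 1)⟩ := by
    rw [Matrix.cons_val_one, Matrix.cons_val_zero, hde]; exact hE1
  refine smoothTrace_cmPrincipalSeries_epFunction_eq_zero_of_blockSums_of_involution L v w hw hvσ hϖ eA ha νQv τ hτ hU hUo hUc hEo hEc d₁ P₀ P₂ P₁ hP₀ hP₂ hP₁ ρ τ₀ hτ₀ τ₂ hτ₂ τ₁ hτ₁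
    hfP₀ hf0₀ hfP₂ hf0₂ hfP₁ hf0₁ χ _ _ (fun _ : Unit => a (1 : Gqs L v) (τ.head d₁)) (fun _ : Unit => a (1 : Gqs L v) (τ.tail d₁))
    (fun i : Fin 2 => (a (![(1 : Gqs L v), τM * eA.symm (weylLongU (galAdicCompletionMap (L := L) (IsCMField.complexConj L) hw) rfl)] i)).mapEdgeSet d₁)
    hm₀ hm₂ hm₁ {A 0, A 1} (fun b => ?_) (fun _ _ _ => Subsingleton.elim _ _) (fun _ _ _ => Subsingleton.elim _ _) (fun _ _ => ?_)
    {⟨s(A 0, A (0 + 1)), (SimpleGraph.mem_edgeSet _).2 (latticeGraph_adj_apartmentEnum_succ_of_involution hσ hvσ hϖ A hA0 hA1 0)⟩,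
      ⟨s(A 1, A (1 + 1)), (SimpleGraph.mem_edgeSet _).2 (latticeGraph_adj_apartmentEnum_succ_of_involution hσ hvσ hϖ A hA0 hA1 1)⟩} (fun b => ?_) (fun i j hij => ?_) hEuler
  · -- `S₀ = {A 0, A 1}` is the set of the two vertex representatives
    refine (Finset.mem_insert.trans (or_congr Iff.rfl Finset.mem_singleton)).trans ?_
    rw [exists_const, exists_const, hone, hone, hhd, htl]
    exact ⟨fun h => h.elim (fun h => Or.inl h.symm) fun h => Or.inr h.symm, fun h => h.elim (fun h => Or.inl h.symm) fun h => Or.inr h.symm⟩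
  · -- the two vertex representatives are distinct
    rw [hone, hone, hhd, htl]; exact h01
  · -- `S₁ = {e₀, e₁}` is the set of the two edge representatives
    refine (Finset.mem_insert.trans (or_congr Iff.rfl Finset.mem_singleton)).trans ⟨fun h => ?_, fun h => ?_⟩
    · rcases h with rfl | rfl
      · exact ⟨0, hg0⟩
      · exact ⟨1, hg1⟩
    · obtain ⟨j, rfl⟩ := h
      fin_cases j
      · exact Or.inl hg0
      · exact Or.inr hg1
  · -- the edge representatives are injective on `Fin 2`
    fin_cases i <;> fin_cases j
    · rfl
    · exact absurd (hg0.symm.trans (hij.trans hg1)) he01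
    · exact absurd (hg0.symm.trans (hij.symm.trans hg1)) he01
    · rfl

end Discharge

end Summit.HodgeConjecture.HodgeConjecture.Cruxes.H413.F0P3cStCharTSEPInducedTraceZeroAtDatumRamified

end
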